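import Mathlib.Analysis.Calculus.ContDiff.Polynomial
import Literature.Probability.Percolation.OneArmHittingPDEAnalytic
import Literature.Analysis.SpecialFunctions.JacobiHeatSmallTime
import Literature.Probability.RandomPlanarGeometry.RadialBesselODE
import HarnessLib

/-!
# The series solution of LSW's boundary problem: eigen-terms, envelopes, small time (proofs only)

Topic `Literature/Probability/Percolation`; family `crit-perc`. Def-free sequel of
`OneArmSeriesSolution.lean` / `OneArmHittingPDEAnalytic.lean` (the explicit solution
`u = lswSeries κ (lswInitCoeff κ)`, `u(θ, t) = Σ_k γ_k e^{-λ_k t} φ_k(θ)`, of the boundary problem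
of Lawler–Schramm–Werner, *One-arm exponent for critical 2D percolation*, Electron. J. Probab. **7**
(2002), paper no. 2, Lemma 2.2, (2.2)–(2.4), (2.12)) preparing its probabilistic (renewal)
representation (2.10) along the radial Bessel process (2.11):

* `lswSeries_eq_tsum` — `u(θ, t) = Σ' k, γ_k e^{-λ_k t} φ_k(θ)` with the eigenfunctions
  `φ_k = lswEigenfun κ k` and eigenvalues `λ_k = lswEigenvalue κ k` of `OneArmEigenfunctions`;
* `exists_bound_lswInitCoeff_mul_lswEigenfun`, `abs_lswTerm_le`, `summable_lswTerm_bound` — the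
  uniform envelope `|γ_k φ_k(θ)| ≤ A (k + 1)` on `[0, 2π]` and the resulting domination
  `|γ_k e^{-λ_k r} φ_k(θ)| ≤ A (k + 1) ρ₀^k`, `ρ₀ = e^{-(κ/8) r₀} < 1`, for `r ≥ r₀ > 0`;
* `lswOp_deriv_lswEigenfun`, `contDiffOn_lswEigenfun` — `Λ φ_k + λ_k φ_k = 0` on `(0, 2π)` in the
  `deriv`/`iteratedDeriv 2` form used by the radial Bessel files, and `φ_k ∈ C²(0, 2π)`;
* `continuousOn_lswSeries_init_prod` — joint continuity of `u` on `(0, 2π] × (0, ∞)`;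
* `exists_one_sub_le_lswSeries_init`, `lswSeries_init_tendsto_one` — **the initial condition in the
  interior**: `u(·, t) → 1` as `t ↓ 0` uniformly on `[θ₀, 2π]` (`θ₀ > 0`), from
  `JacobiHeatSmallTime`;
* `lswHit_two_pi_continuous` — the trace `t ↦ u(2π, t)` (`lswHit κ (2π) ·`, `= 1` for `t ≤ 0`) is
  continuous on `ℝ` (`e^{-λt} ≤ u(2π, t) ≤ 1`).

No definitions, no named facts.

## References

* G. F. Lawler, O. Schramm, W. Werner, *One-arm exponent for critical 2D percolation*, Electron.
  J. Probab. 7 (2002), no. 2, §2: Lemma 2.2, (2.2)–(2.4), (2.10). [LawlerSchrammWernerEJP2002]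
-/

noncomputable section

open Real Set Filter
open scoped Topology

namespace Literature.Probability.Percolation

open Literature.Analysis.SpecialFunctions

section Terms

variable {κ : ℝ} (hκ : 4 < κ)
include hκ

/-- `1 < c` (abbreviation). [folklore] -/
private theorem hc1T : 1 < lswJacobiParam κ := one_lt_lswJacobiParam hκ
/-- `c < 2` (abbreviation). [folklore] -/
private theorem hc2T : lswJacobiParam κ < 2 := lswJacobiParam_lt_two (by linarith)
/-- `0 < κ/8` (abbreviation). [folklore] -/
private theorem hμT : 0 < κ / 8 := by linarith

/-! ### The eigenfunction expansion as a `tsum` -/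

omit hκ in
/-- **`u = Σ γ_k e^{-λ_k t} φ_k`**: the series solution `lswSeries κ γ` is the sum of the separated
solutions `γ_k e^{-λ_k t} φ_k(θ)` (`λ_k = λ + (κ/8) k(k+1)`), for all real `θ, t` (both sides are
the same `tsum`, summable or not). [cite: LawlerSchrammWernerEJP2002, Lemma 2.2] -/
theorem lswSeries_eq_tsum (γ : ℕ → ℝ) (θ t : ℝ) :
    lswSeries κ γ θ t = ∑' k, γ k * Real.exp (-(lswEigenvalue κ k * t)) * lswEigenfun κ k θ := by
  unfold lswSeries lswLift jacobiHeat
  rw [← tsum_mul_left, ← tsum_mul_left]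
  refine tsum_congr fun k => ?_
  unfold jacobiHeatTerm lswEigenfun lswLift lswEigenvalue
  rw [show -((lswLambda κ + κ / 8 * k * (k + 1)) * t) = -(lswLambda κ * t) + -(κ / 8 * k * (k + 1) * t)
    by ring, Real.exp_add]
  ring

/-! ### Envelopes -/

/-- **Uniform envelope of the eigen-terms**: there is `A ≥ 0` with `|γ_k φ_k(θ)| ≤ A (k + 1)` for
all `k` and `θ ∈ [0, 2π]` (`γ = lswInitCoeff κ`): `|γ_k y_k(z)| ≤ A (k+1) z^{(1-c)/2}`
(`exists_envelope`) and `φ_k = z^{c-1} y_k(z)`, `z = sin²(θ/4) ≤ 1`. [folklore] -/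
theorem exists_bound_lswInitCoeff_mul_lswEigenfun :
    ∃ A : ℝ, 0 ≤ A ∧ ∀ (k : ℕ) (θ : ℝ), θ ∈ Icc 0 (2 * π) →
      |lswInitCoeff κ k * lswEigenfun κ k θ| ≤ A * ((k : ℝ) + 1) := by
  obtain ⟨A, hA0, hA⟩ := exists_envelope (hc1T hκ) (hc2T hκ) (c := lswJacobiParam κ)
  refine ⟨A, hA0, fun k θ hθ => ?_⟩
  rcases hθ.1.eq_or_lt with h0 | h0
  · rw [← h0, lswEigenfun_zero_left hκ, mul_zero, abs_zero]; positivity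
  · have hs : 0 < Real.sin (θ / 4) := sin_quarter_pos h0 hθ.2
    set z : ℝ := Real.sin (θ / 4) ^ 2 with hz
    have hzm : z ∈ Ioc (0 : ℝ) 1 :=
      ⟨by positivity, by nlinarith [Real.sin_sq_add_cos_sq (θ / 4), Real.sin_le_one (θ / 4)]⟩
    have hκ0 : κ ≠ 0 := by linarith
    -- `sin(θ/4)^q = z^{c-1}`
    have hsq : Real.sin (θ / 4) ^ lswQ κ = z ^ (lswJacobiParam κ - 1) := by
      rw [hz, ← Real.rpow_natCast, ← Real.rpow_mul hs.le, lswQ_eq_two_mul hκ0]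
      push_cast; ring_nf
    have hφ : lswEigenfun κ k θ = Real.sin (θ / 4) ^ lswQ κ *
        (hypJacobi (lswJacobiParam κ) k).eval z := rfl
    have h1 := hA k z hzm
    rw [hφ, hsq, show lswInitCoeff κ k * (z ^ (lswJacobiParam κ - 1) *
        (hypJacobi (lswJacobiParam κ) k).eval z) = z ^ (lswJacobiParam κ - 1) *
        (jacobiInitCoeff (lswJacobiParam κ) k * (hypJacobi (lswJacobiParam κ) k).eval z) by
      simp only [lswInitCoeff]; ring, abs_mul, abs_of_pos (Real.rpow_pos_of_pos hzm.1 _)]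
    have h2 : z ^ (lswJacobiParam κ - 1) * (A * ((k : ℝ) + 1) * z ^ ((1 - lswJacobiParam κ) / 2))
        = A * ((k : ℝ) + 1) * z ^ ((lswJacobiParam κ - 1) / 2) := by
      rw [show z ^ (lswJacobiParam κ - 1) * (A * ((k : ℝ) + 1) * z ^ ((1 - lswJacobiParam κ) / 2))
        = A * ((k : ℝ) + 1) * (z ^ (lswJacobiParam κ - 1) * z ^ ((1 - lswJacobiParam κ) / 2)) by ring,
        ← Real.rpow_add hzm.1]
      congr 2; ring
    have h3 : z ^ ((lswJacobiParam κ - 1) / 2) ≤ 1 :=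
      Real.rpow_le_one hzm.1.le hzm.2 (by have := hc1T hκ; linarith)
    calc z ^ (lswJacobiParam κ - 1) * |jacobiInitCoeff (lswJacobiParam κ) k *
          (hypJacobi (lswJacobiParam κ) k).eval z|
        ≤ z ^ (lswJacobiParam κ - 1) * (A * ((k : ℝ) + 1) * z ^ ((1 - lswJacobiParam κ) / 2)) :=
          mul_le_mul_of_nonneg_left h1 (Real.rpow_nonneg hzm.1.le _)
      _ = A * ((k : ℝ) + 1) * z ^ ((lswJacobiParam κ - 1) / 2) := h2
      _ ≤ A * ((k : ℝ) + 1) * 1 := mul_le_mul_of_nonneg_left h3 (by positivity)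
      _ = A * ((k : ℝ) + 1) := mul_one _

/-- **Domination of the eigen-terms for `r ≥ r₀ > 0`**: with the envelope constant `A`,
`|γ_k e^{-λ_k r} φ_k(θ)| ≤ A (k+1) (e^{-(κ/8) r₀})^k` for `θ ∈ [0, 2π]`, `r ≥ r₀`
(`e^{-λ r} ≤ 1`, `e^{-(κ/8)k(k+1)r} ≤ (e^{-(κ/8) r₀})^k`). [folklore] -/
theorem abs_lswTerm_le {A : ℝ}
    (hA : ∀ (k : ℕ) (θ : ℝ), θ ∈ Icc 0 (2 * π) → |lswInitCoeff κ k * lswEigenfun κ k θ| ≤ A * ((k : ℝ) + 1))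
    {r₀ : ℝ} (hr₀ : 0 < r₀) (k : ℕ) {θ r : ℝ} (hθ : θ ∈ Icc 0 (2 * π)) (hr : r₀ ≤ r) :
    |lswInitCoeff κ k * Real.exp (-(lswEigenvalue κ k * r)) * lswEigenfun κ k θ|
      ≤ A * ((k : ℝ) + 1) ^ 1 * Real.exp (-(κ / 8 * r₀)) ^ k := by
  have hA0 : 0 ≤ A * ((k : ℝ) + 1) := (abs_nonneg _).trans (hA k θ hθ)
  have hexp : Real.exp (-(lswEigenvalue κ k * r)) ≤ Real.exp (-(κ / 8 * r₀)) ^ k := by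
    unfold lswEigenvalue
    rw [show -((lswLambda κ + κ / 8 * k * (k + 1)) * r) = -(lswLambda κ * r) + -(κ / 8 * k * (k + 1) * r)
      by ring, Real.exp_add]
    have h1 : Real.exp (-(lswLambda κ * r)) ≤ 1 := by
      rw [Real.exp_le_one_iff]
      have := mul_nonneg (lswLambda_pos hκ).le (hr₀.le.trans hr)
      linarith
    have h2 := exp_heat_le (hμT hκ).le hr₀.le hr k
    calc Real.exp (-(lswLambda κ * r)) * Real.exp (-(κ / 8 * k * (k + 1) * r))
        ≤ 1 * Real.exp (-(κ / 8 * r₀)) ^ k :=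
          mul_le_mul h1 h2 (Real.exp_pos _).le zero_le_one
      _ = _ := one_mul _
  rw [show lswInitCoeff κ k * Real.exp (-(lswEigenvalue κ k * r)) * lswEigenfun κ k θ
      = (lswInitCoeff κ k * lswEigenfun κ k θ) * Real.exp (-(lswEigenvalue κ k * r)) by ring,
    abs_mul, abs_of_pos (Real.exp_pos _), pow_one]
  exact mul_le_mul (hA k θ hθ) hexp (Real.exp_pos _).le hA0

/-- The dominating sequence `A (k+1) (e^{-(κ/8) r₀})^k` is summable (`r₀ > 0`). [folklore] -/
theorem summable_lswTerm_bound (A : ℝ) {r₀ : ℝ} (hr₀ : 0 < r₀) :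
    Summable fun k : ℕ => A * ((k : ℝ) + 1) ^ 1 * Real.exp (-(κ / 8 * r₀)) ^ k :=
  summable_heat_bound (hμT hκ) hr₀ A 1

/-- The eigen-expansion of `u(θ, r)` is summable for `θ ∈ [0, 2π]`, `r > 0` (`γ = lswInitCoeff κ`).
[folklore] -/
theorem summable_lswTerm {θ r : ℝ} (hθ : θ ∈ Icc 0 (2 * π)) (hr : 0 < r) :
    Summable fun k : ℕ =>
      lswInitCoeff κ k * Real.exp (-(lswEigenvalue κ k * r)) * lswEigenfun κ k θ := by
  obtain ⟨A, -, hA⟩ := exists_bound_lswInitCoeff_mul_lswEigenfun hκ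
  refine Summable.of_norm_bounded (summable_lswTerm_bound hκ A hr) fun k => ?_
  rw [Real.norm_eq_abs]
  exact abs_lswTerm_le hκ hA hr k hθ le_rfl

/-! ### The eigenfunctions in `deriv` form -/

omit hκ in
/-- `deriv φ_k = φ_k'` near every point of `(0, 4π)` (where `sin(θ/4) > 0`). [folklore] -/
theorem deriv_lswEigenfun_eventuallyEq (k : ℕ) {θ : ℝ} (hs : 0 < Real.sin (θ / 4)) :
    deriv (lswEigenfun κ k) =ᶠ[𝓝 θ] lswEigenfunD κ k := by
  have hev : ∀ᶠ y in 𝓝 θ, 0 < Real.sin (y / 4) :=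
    (Real.continuous_sin.comp (continuous_id.div_const (4 : ℝ))).continuousAt.eventually
      (lt_mem_nhds hs)
  filter_upwards [hev] with y hy
  exact (hasDerivAt_lswEigenfun κ k hy).deriv

omit hκ in
/-- `deriv φ_k (θ) = φ_k'(θ)` and `iteratedDeriv 2 φ_k (θ) = φ_k''(θ)` where `sin(θ/4) > 0`.
[folklore] -/
theorem iteratedDeriv_two_lswEigenfun (k : ℕ) {θ : ℝ} (hs : 0 < Real.sin (θ / 4)) :
    deriv (lswEigenfun κ k) θ = lswEigenfunD κ k θ ∧
      iteratedDeriv 2 (lswEigenfun κ k) θ = lswEigenfunDD κ k θ := by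
  refine ⟨(hasDerivAt_lswEigenfun κ k hs).deriv, ?_⟩
  rw [iteratedDeriv_succ, iteratedDeriv_one, (deriv_lswEigenfun_eventuallyEq k hs).deriv_eq]
  exact (hasDerivAt_lswEigenfunD κ k hs).deriv

/-- **`Λ φ_k + λ_k φ_k = 0` on `(0, 2π)`, `deriv` form**:
`(κ/2) (iteratedDeriv 2 φ_k) + cot(θ/2) (deriv φ_k) - (-(-λ_k φ_k)) = 0`, i.e.
`lswOp κ θ (iteratedDeriv 2 φ_k θ) (deriv φ_k θ) (-(λ_k φ_k θ)) = 0` — the form of the weighted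
generator `Λ_{λ_k} φ_k = 0` of the radial Bessel files. [cite: LawlerSchrammWernerEJP2002, Lemma 2.2, (2.4)] -/
theorem lswOp_deriv_lswEigenfun (k : ℕ) {θ : ℝ} (hθ : θ ∈ Ioo 0 (2 * π)) :
    lswOp κ θ (iteratedDeriv 2 (lswEigenfun κ k) θ) (deriv (lswEigenfun κ k) θ)
      (-(lswEigenvalue κ k * lswEigenfun κ k θ)) = 0 := by
  obtain ⟨h1, h2⟩ := iteratedDeriv_two_lswEigenfun k (sin_quarter_pos hθ.1 hθ.2.le) (κ := κ)
  rw [h1, h2]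
  exact lswOp_lswEigenfun hκ k hθ

omit hκ in
/-- **`φ_k ∈ C²(0, 2π)`** (`sin(·/4)^q` is `C²` where `sin > 0`, times a polynomial in `sin²(·/4)`).
[folklore] -/
theorem contDiffOn_lswEigenfun (k : ℕ) : ContDiffOn ℝ 2 (lswEigenfun κ k) (Ioo 0 (2 * π)) := by
  have h1 : ContDiffOn ℝ 2 (fun y : ℝ => Real.sin (y / 4) ^ lswQ κ) (Ioo 0 (2 * π)) :=
    Literature.Probability.RandomPlanarGeometry.RadialLoewner.contDiffOn_sinPow 4
      fun y hy => sin_quarter_pos hy.1 hy.2.le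
  have h2 : ContDiff ℝ 2 fun y : ℝ => (hypJacobi (lswJacobiParam κ) k).eval (Real.sin (y / 4) ^ 2) := by
    have := ((hypJacobi (lswJacobiParam κ) k).contDiff_aeval 2).comp
      ((Real.contDiff_sin.comp (contDiff_id.div_const (4 : ℝ))).pow 2)
    simpa only [Polynomial.coe_aeval_eq_eval, Function.comp_def, id_eq] using this
  exact h1.mul h2.contDiffOn

/-! ### Joint continuity and the values on `(0, 2π] × (0, ∞)` -/

/-- **`u` is jointly continuous on `(0, 2π] × (0, ∞)`** (`γ = lswInitCoeff κ`). [folklore] -/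
theorem continuousOn_lswSeries_init_prod :
    ContinuousOn (fun p : ℝ × ℝ => lswSeries κ (lswInitCoeff κ) p.1 p.2) (Ioc 0 (2 * π) ×ˢ Ioi 0) := by
  have hY := continuousOn_jacobiHeat' (hc1T hκ) (hc2T hκ) (hμT hκ) (lswInitCoeff_hyp hκ)
  have hmap : MapsTo (fun p : ℝ × ℝ => (Real.sin (p.1 / 4) ^ 2, p.2)) (Ioc 0 (2 * π) ×ˢ Ioi 0)
      (Ioc 0 1 ×ˢ Ioi 0) := by
    intro p hp
    have hs := sin_quarter_pos hp.1.1 hp.1.2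
    exact ⟨⟨by positivity, by nlinarith [Real.sin_sq_add_cos_sq (p.1 / 4), Real.sin_le_one (p.1 / 4)]⟩,
      hp.2⟩
  have hcomp : ContinuousOn (fun p : ℝ × ℝ => jacobiHeat (lswJacobiParam κ) (κ / 8) (lswInitCoeff κ)
      (Real.sin (p.1 / 4) ^ 2) p.2) (Ioc 0 (2 * π) ×ˢ Ioi 0) :=
    hY.comp (by fun_prop) hmap
  unfold lswSeries lswLift
  refine ContinuousOn.mul (by fun_prop) (ContinuousOn.mul ?_ hcomp)
  exact ContinuousOn.rpow_const (by fun_prop) fun p _ => Or.inr (lswQ_pos hκ).le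

/-- `u(θ, ·)` is continuous on `(0, ∞)` for `θ ∈ (0, 2π]` (general `κ > 4`). [folklore] -/
theorem continuousOn_lswSeries_init_t' {θ : ℝ} (hθ : θ ∈ Ioc 0 (2 * π)) :
    ContinuousOn (fun s => lswSeries κ (lswInitCoeff κ) θ s) (Ioi 0) :=
  (continuousOn_lswSeries_init_prod hκ).comp (Continuous.prodMk_right θ).continuousOn
    fun _ hs => ⟨hθ, hs⟩

/-- `|u(θ, r)| ≤ 1` for `θ ∈ [0, 2π]`, `r > 0`. [folklore] -/
theorem abs_lswSeries_init_le_one {θ r : ℝ} (hθ : θ ∈ Icc 0 (2 * π)) (hr : 0 < r) :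
    |lswSeries κ (lswInitCoeff κ) θ r| ≤ 1 := by
  rcases hθ.1.eq_or_lt with h0 | h0
  · rw [← h0, lswSeries_init_zero hκ, abs_zero]; exact zero_le_one
  · rw [abs_of_pos (lswSeries_init_pos hκ ⟨h0, hθ.2⟩ hr)]
    exact lswSeries_init_le_one hκ ⟨h0, hθ.2⟩ hr

/-! ### The initial condition in the interior -/

/-- **Small-time lower bound in `θ`**: for `θ₀ ∈ (0, 2π]` and `η > 0` there is `t₀ > 0` with
`1 - η ≤ u(θ, t)` for `t ∈ (0, t₀)`, `θ ∈ [θ₀, 2π]` (`u = e^{-λt} z^{c-1} Y(z, t)`, `z = sin²(θ/4)`,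
and `Y(z, t) ≥ z^{1-c} - η'` by `exists_sub_le_initHeat`). [cite: LawlerSchrammWernerEJP2002, Lemma 2.2, (2.2)] -/
theorem exists_one_sub_le_lswSeries_init {θ₀ : ℝ} (hθ₀ : θ₀ ∈ Ioc 0 (2 * π)) {η : ℝ} (hη : 0 < η) :
    ∃ t₀ : ℝ, 0 < t₀ ∧ ∀ t ∈ Ioo 0 t₀, ∀ θ ∈ Icc θ₀ (2 * π),
      1 - η ≤ lswSeries κ (lswInitCoeff κ) θ t := by
  have hκ0 : κ ≠ 0 := by linarith
  have hlam := lswLambda_pos hκ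
  set a : ℝ := Real.sin (θ₀ / 4) ^ 2 with ha
  have hs₀ : 0 < Real.sin (θ₀ / 4) := sin_quarter_pos hθ₀.1 hθ₀.2
  have ha0 : 0 < a := by positivity
  obtain ⟨t₁, ht₁, hlow⟩ := exists_sub_le_initHeat (hc1T hκ) (hc2T hκ) (hμT hκ) ha0
    (half_pos hη) (μ := κ / 8)
  -- `t₀ = min t₁ (η / (2λ))`
  refine ⟨min t₁ (η / (2 * lswLambda κ)), lt_min ht₁ (by positivity), fun t ht θ hθ => ?_⟩
  have ht1 : t ∈ Ioo 0 t₁ := ⟨ht.1, ht.2.trans_le (min_le_left _ _)⟩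
  have ht2 : t < η / (2 * lswLambda κ) := ht.2.trans_le (min_le_right _ _)
  have hθ' : θ ∈ Ioc 0 (2 * π) := ⟨hθ₀.1.trans_le hθ.1, hθ.2⟩
  have hs : 0 < Real.sin (θ / 4) := sin_quarter_pos hθ'.1 hθ'.2
  set z : ℝ := Real.sin (θ / 4) ^ 2 with hz
  -- `z ∈ [a, 1]`
  have hsin_mono : Real.sin (θ₀ / 4) ≤ Real.sin (θ / 4) :=
    Real.sin_le_sin_of_le_of_le_pi_div_two (by linarith [hθ₀.1, Real.pi_pos]) (by linarith [hθ.2])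
      (by linarith [hθ.1])
  have hzmem : z ∈ Icc a 1 :=
    ⟨by rw [hz, ha]; exact pow_le_pow_left₀ hs₀.le hsin_mono 2,
      by nlinarith [Real.sin_sq_add_cos_sq (θ / 4), Real.sin_le_one (θ / 4)]⟩
  have hzpos : 0 < z := by positivity
  have hY := hlow t ht1 z hzmem
  -- `u = e^{-λt} (sin^q Y)` and `sin^q z^{1-c} = 1`
  have hsq : Real.sin (θ / 4) ^ lswQ κ * z ^ (1 - lswJacobiParam κ) = 1 := by
    rw [hz, ← Real.rpow_natCast, ← Real.rpow_mul hs.le, ← Real.rpow_add hs, lswQ_eq_two_mul hκ0]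
    push_cast
    rw [show 2 * (lswJacobiParam κ - 1) + 2 * (1 - lswJacobiParam κ) = 0 by ring, Real.rpow_zero]
  have hsq1 : Real.sin (θ / 4) ^ lswQ κ ≤ 1 :=
    Real.rpow_le_one hs.le (Real.sin_le_one _) (lswQ_pos hκ).le
  have hsq0 : 0 ≤ Real.sin (θ / 4) ^ lswQ κ := Real.rpow_nonneg hs.le _
  rw [lswSeries_init_eq]
  -- `sin^q Y ≥ sin^q (z^{1-c} - η/2) = 1 - (η/2) sin^q ≥ 1 - η/2`
  have h1 : 1 - η / 2 ≤ Real.sin (θ / 4) ^ lswQ κ * initHeat (lswJacobiParam κ) (κ / 8) z t := by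
    have := mul_le_mul_of_nonneg_left hY hsq0
    rw [mul_sub, hsq] at this
    nlinarith
  -- `e^{-λt} ≥ 1 - λ t ≥ 1 - η/2`
  have h2 : 1 - η / 2 ≤ Real.exp (-(lswLambda κ * t)) := by
    have h3 := Real.add_one_le_exp (-(lswLambda κ * t))
    have h4 : lswLambda κ * t ≤ η / 2 := by
      have := (lt_div_iff₀ (by positivity : (0 : ℝ) < 2 * lswLambda κ)).1 ht2
      linarith
    linarith
  have h5 : 0 ≤ Real.exp (-(lswLambda κ * t)) := (Real.exp_pos _).le
  rw [← hz]
  rcases le_or_gt (η / 2) 1 with hη1 | hη1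
  · calc 1 - η ≤ (1 - η / 2) * (1 - η / 2) := by nlinarith
      _ ≤ Real.exp (-(lswLambda κ * t)) * (Real.sin (θ / 4) ^ lswQ κ *
          initHeat (lswJacobiParam κ) (κ / 8) z t) :=
          mul_le_mul h2 h1 (by linarith) h5
  · -- `η > 2`: the bound is trivial since `u > 0`
    have hpos := lswSeries_init_pos hκ hθ' ht.1
    rw [lswSeries_init_eq, ← hz] at hpos
    linarith

/-- **`u(·, t) → 1` as `t ↓ 0`, uniformly on `[θ₀, 2π]`** (`θ₀ ∈ (0, 2π]`): for `η > 0` there is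
`t₀ > 0` with `|u(θ, t) - 1| ≤ η` for `t ∈ (0, t₀)`, `θ ∈ [θ₀, 2π]` (lower bound above, `u ≤ 1`).
This is LSW's "`h(θ, t) = 1` for `t ≤ 0`" read as the initial condition of the semigroup solution
in the interior. [cite: LawlerSchrammWernerEJP2002, Lemma 2.2, (2.2), (2.10)] -/
theorem lswSeries_init_tendsto_one {θ₀ : ℝ} (hθ₀ : θ₀ ∈ Ioc 0 (2 * π)) {η : ℝ} (hη : 0 < η) :
    ∃ t₀ : ℝ, 0 < t₀ ∧ ∀ t ∈ Ioo 0 t₀, ∀ θ ∈ Icc θ₀ (2 * π),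
      |lswSeries κ (lswInitCoeff κ) θ t - 1| ≤ η := by
  obtain ⟨t₀, ht₀, h⟩ := exists_one_sub_le_lswSeries_init hκ hθ₀ hη
  refine ⟨t₀, ht₀, fun t ht θ hθ => ?_⟩
  have hθ' : θ ∈ Ioc 0 (2 * π) := ⟨hθ₀.1.trans_le hθ.1, hθ.2⟩
  rw [abs_sub_le_iff]
  exact ⟨by linarith [lswSeries_init_le_one hκ hθ' ht.1], by linarith [h t ht θ hθ]⟩

/-! ### `lswHit` at positive times -/

omit hκ in
/-- `lswHit κ θ t = u(θ, t)` for `t > 0`, `θ ∈ [0, 2π]` (general `κ`). [folklore] -/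
theorem lswHit_eq_lswSeries {θ t : ℝ} (ht : 0 < t) (hθ : θ ∈ Icc 0 (2 * π)) :
    lswHit κ θ t = lswSeries κ (lswInitCoeff κ) θ t := by
  rw [lswHit, if_neg (not_le.2 ht), clampTwoPi_of_mem hθ]

omit hκ in
/-- The clamp to `[0, 2π]` is continuous. [folklore] -/
theorem continuous_clampTwoPi : Continuous clampTwoPi := by
  unfold clampTwoPi; fun_prop

/-- `θ ↦ u(θ, r)` is continuous on `[0, 2π]` for `r > 0` (`u(θ, r) → 0 = u(0, r)` as `θ ↓ 0`).
[cite: LawlerSchrammWernerEJP2002, (2.3)] -/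
theorem continuousOn_lswSeries_init_Icc {r : ℝ} (hr : 0 < r) :
    ContinuousOn (fun θ => lswSeries κ (lswInitCoeff κ) θ r) (Icc 0 (2 * π)) := by
  intro θ hθ
  rcases hθ.1.eq_or_lt with h0 | h0
  · -- at `θ = 0`
    subst h0
    have h := tendsto_lswSeries_zero hκ (lswInitCoeff_hyp hκ) hr
    have h' : ContinuousWithinAt (fun θ => lswSeries κ (lswInitCoeff κ) θ r) (Ici 0) 0 := by
      rw [← continuousWithinAt_Ioi_iff_Ici, ContinuousWithinAt, lswSeries_init_zero hκ]
      exact h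
    exact h'.mono fun x hx => hx.1
  · have hc := (continuousOn_lswSeries_init_prod hκ).comp (Continuous.prodMk_left r).continuousOn
      (fun x (hx : x ∈ Ioc 0 (2 * π)) => show (x, r) ∈ Ioc 0 (2 * π) ×ˢ Ioi 0 from ⟨hx, hr⟩)
    have hθ' : θ ∈ Ioc 0 (2 * π) := ⟨h0, hθ.2⟩
    have h1 : ContinuousWithinAt (fun θ => lswSeries κ (lswInitCoeff κ) θ r) (Ioc 0 (2 * π)) θ := hc θ hθ'
    refine (h1.mono_of_mem_nhdsWithin ?_)
    exact mem_nhdsWithin.2 ⟨Ioi 0, isOpen_Ioi, h0, fun x hx => ⟨hx.1, hx.2.2⟩⟩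

/-- **`θ ↦ lswHit κ θ r` is continuous on `ℝ` for `r > 0`** (the series on `[0, 2π]` composed
with the clamp). [folklore] -/
theorem continuous_lswHit_of_pos {r : ℝ} (hr : 0 < r) : Continuous fun θ => lswHit κ θ r := by
  have heq : (fun θ => lswHit κ θ r) = (fun θ => lswSeries κ (lswInitCoeff κ) θ r) ∘ clampTwoPi := by
    funext θ; simp only [Function.comp_apply, lswHit, if_neg (not_le.2 hr)]
  rw [heq]
  exact (continuousOn_lswSeries_init_Icc hκ hr).comp_continuous continuous_clampTwoPi clampTwoPi_mem

/-! ### The trace at `2π` is continuous on `ℝ` -/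

/-- `e^{-λt} ≤ u(2π, t) ≤ 1` for `t > 0`, in terms of `lswHit`. [folklore] -/
theorem exp_le_lswHit_two_pi {t : ℝ} (ht : 0 < t) :
    Real.exp (-(lswLambda κ * t)) ≤ lswHit κ (2 * π) t ∧ lswHit κ (2 * π) t ≤ 1 := by
  have h2π : (2 * π) ∈ Ioc 0 (2 * π) := ⟨by positivity, le_rfl⟩
  rw [lswHit, if_neg (not_le.2 ht), clampTwoPi_of_mem ⟨by positivity, le_rfl⟩]
  refine ⟨?_, lswSeries_init_le_one hκ h2π ht⟩
  have h := lswH_le_lswSeries_init hκ h2π ht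
  rwa [show 2 * π / 4 = π / 2 by ring, Real.sin_pi_div_two, Real.one_rpow, mul_one] at h

/-- `0 ≤ lswHit κ θ t ≤ 1` everywhere (general `κ > 4`). [folklore] -/
theorem lswHit_mem_Icc' (θ t : ℝ) : lswHit κ θ t ∈ Icc (0 : ℝ) 1 := by
  unfold lswHit
  split_ifs with ht
  · exact ⟨zero_le_one, le_rfl⟩
  · push Not at ht
    have hmem := clampTwoPi_mem θ
    rcases hmem.1.eq_or_lt with h0 | h0
    · rw [← h0, lswSeries_init_zero hκ]; exact ⟨le_rfl, zero_le_one⟩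
    · exact ⟨(lswSeries_init_pos hκ ⟨h0, hmem.2⟩ ht).le, lswSeries_init_le_one hκ ⟨h0, hmem.2⟩ ht⟩

/-- **The trace `G(t) = u(2π, t)` (`= 1` for `t ≤ 0`) is continuous on `ℝ`**: continuous on
`(0, ∞)` (the series), constant on `(-∞, 0]`, and `G(t) → 1 = G(0)` as `t ↓ 0` by
`e^{-λt} ≤ G(t) ≤ 1`. [folklore] -/
theorem lswHit_two_pi_continuous : Continuous fun t => lswHit κ (2 * π) t := by
  have h2π : (2 * π) ∈ Ioc 0 (2 * π) := ⟨by positivity, le_rfl⟩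
  have hser : ∀ t, 0 < t → lswHit κ (2 * π) t = lswSeries κ (lswInitCoeff κ) (2 * π) t := fun t ht => by
    rw [lswHit, if_neg (not_le.2 ht), clampTwoPi_of_mem ⟨by positivity, le_rfl⟩]
  refine continuous_iff_continuousAt.2 fun t => ?_
  rcases lt_trichotomy t 0 with ht | ht | ht
  · -- locally constant `1`
    refine (continuousAt_const (y := (1 : ℝ))).congr ?_
    filter_upwards [Iio_mem_nhds ht] with s hs
    rw [lswHit, if_pos (le_of_lt hs)]
  · subst ht
    rw [continuousAt_iff_continuous_left'_right']
    constructor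
    · refine (continuousAt_const (y := (1 : ℝ))).continuousWithinAt.congr (fun s hs => ?_) ?_
      · rw [lswHit, if_pos (le_of_lt hs)]
      · rw [lswHit, if_pos le_rfl]
    · -- squeeze from the right
      have hval : lswHit κ (2 * π) 0 = 1 := by rw [lswHit, if_pos le_rfl]
      rw [ContinuousWithinAt, hval]
      have hlo : Tendsto (fun t : ℝ => Real.exp (-(lswLambda κ * t))) (𝓝[>] 0) (𝓝 1) := by
        have h : Tendsto (fun t : ℝ => Real.exp (-(lswLambda κ * t))) (𝓝 0)
            (𝓝 (Real.exp (-(lswLambda κ * 0)))) :=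
          (Real.continuous_exp.comp (continuous_const.mul continuous_id).neg).tendsto 0
        rw [mul_zero, neg_zero, Real.exp_zero] at h
        exact h.mono_left nhdsWithin_le_nhds
      refine tendsto_of_tendsto_of_tendsto_of_le_of_le' hlo tendsto_const_nhds ?_ ?_
      · filter_upwards [self_mem_nhdsWithin] with s hs using (exp_le_lswHit_two_pi hκ hs).1
      · filter_upwards [self_mem_nhdsWithin] with s hs using (exp_le_lswHit_two_pi hκ hs).2
  · have hc := (continuousOn_lswSeries_init_t' hκ h2π).continuousAt (Ioi_mem_nhds ht)
    refine hc.congr ?_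
    filter_upwards [Ioi_mem_nhds ht] with s hs
    exact (hser s hs).symm


/-- **`t ↦ lswHit κ θ t` is continuous on `ℝ` for `θ ∈ (0, 2π]`**: constant `1` on `(-∞, 0]`, the
series on `(0, ∞)`, and `u(θ, t) → 1` as `t ↓ 0` (`lswSeries_init_tendsto_one`). [folklore] -/
theorem continuous_lswHit_of_mem {θ : ℝ} (hθ : θ ∈ Ioc 0 (2 * π)) : Continuous fun t => lswHit κ θ t := by
  have hθ' : θ ∈ Icc 0 (2 * π) := ⟨hθ.1.le, hθ.2⟩
  refine continuous_iff_continuousAt.2 fun t => ?_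
  rcases lt_trichotomy t 0 with ht | ht | ht
  · refine (continuousAt_const (y := (1 : ℝ))).congr ?_
    filter_upwards [Iio_mem_nhds ht] with s hs
    rw [lswHit, if_pos (le_of_lt hs)]
  · subst ht
    rw [continuousAt_iff_continuous_left'_right']
    constructor
    · refine (continuousAt_const (y := (1 : ℝ))).continuousWithinAt.congr (fun s hs => ?_) ?_
      · rw [lswHit, if_pos (le_of_lt hs)]
      · rw [lswHit, if_pos le_rfl]
    · have hval : lswHit κ θ 0 = 1 := by rw [lswHit, if_pos le_rfl]
      rw [ContinuousWithinAt, hval, Metric.tendsto_nhds]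
      intro ε hε
      obtain ⟨t₀, ht₀, h⟩ := lswSeries_init_tendsto_one hκ hθ (half_pos hε)
      filter_upwards [Ioo_mem_nhdsGT ht₀] with s hs
      rw [Real.dist_eq, lswHit_eq_lswSeries hs.1 hθ']
      exact (h s hs θ ⟨le_rfl, hθ.2⟩).trans_lt (half_lt_self hε)
  · have hc := (continuousOn_lswSeries_init_t' hκ hθ).continuousAt (Ioi_mem_nhds ht)
    refine hc.congr ?_
    filter_upwards [Ioi_mem_nhds ht] with s hs
    exact (lswHit_eq_lswSeries hs hθ').symm

end Terms

end Literature.Probability.Percolation
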